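import Summits.RiemannHypothesis.RiemannHypothesis.Theorems.JensenPolynomialsXiGorttwCoeffSmallTableCert

/-!
# Route `JensenPolynomials` — TABLE crux, part 4b: degrees `3 … 11` (compiled evaluation)

`walk_d : walk d (Rtab d) (1/(stab d + 1)) (sTab d) (xiRatioBox.drop (2d³)) (10000 − 2d³) = true` for `d = 3 … 11`
by `native_decide` (COMPUTATIONAL: each theorem depends on its `native_decide` axiom — evidence class J-n2, as for
`Literature…KleinFrickeSevenCertificate`; ≈ 3 min compiled on the farm). Degrees `12 … 17` and the assembly are in
part 4c (`JensenPolynomialsXiGorttwCoeffSmallTable.lean`). RH-FREE; nothing here bears on the truth of RH.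
-/

-- D-0017: `Summit.RiemannHypothesis.RiemannHypothesis.…` duplicates the namespace BY DESIGN (single-problem summit).
set_option linter.dupNamespace false

namespace Summit.RiemannHypothesis.RiemannHypothesis.Theorems.JensenPolynomials.CoeffTable

open Literature.NumberTheory.LFunctions Polynomial Finset
open scoped BigOperators Nat

/-! ## Degrees `3 … 11` (compiled evaluation) -/

/-- Degree `3`: all `9946` cells `2·3³ ≤ n < 10⁴` pass the checker (compiled evaluation, `Lean.ofReduceBool`). -/
theorem walk_3 : walk 3 (Rtab 3) (1 / (stab 3 + 1)) (sTab 3) (xiRatioBox.drop 54) 9946 = true := by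
  native_decide

/-- Degree `4`: all `9872` cells `2·4³ ≤ n < 10⁴` pass the checker (compiled evaluation, `Lean.ofReduceBool`). -/
theorem walk_4 : walk 4 (Rtab 4) (1 / (stab 4 + 1)) (sTab 4) (xiRatioBox.drop 128) 9872 = true := by
  native_decide

/-- Degree `5`: all `9750` cells `2·5³ ≤ n < 10⁴` pass the checker (compiled evaluation, `Lean.ofReduceBool`). -/
theorem walk_5 : walk 5 (Rtab 5) (1 / (stab 5 + 1)) (sTab 5) (xiRatioBox.drop 250) 9750 = true := by
  native_decide

/-- Degree `6`: all `9568` cells `2·6³ ≤ n < 10⁴` pass the checker (compiled evaluation, `Lean.ofReduceBool`). -/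
theorem walk_6 : walk 6 (Rtab 6) (1 / (stab 6 + 1)) (sTab 6) (xiRatioBox.drop 432) 9568 = true := by
  native_decide

/-- Degree `7`: all `9314` cells `2·7³ ≤ n < 10⁴` pass the checker (compiled evaluation, `Lean.ofReduceBool`). -/
theorem walk_7 : walk 7 (Rtab 7) (1 / (stab 7 + 1)) (sTab 7) (xiRatioBox.drop 686) 9314 = true := by
  native_decide

/-- Degree `8`: all `8976` cells `2·8³ ≤ n < 10⁴` pass the checker (compiled evaluation, `Lean.ofReduceBool`). -/
theorem walk_8 : walk 8 (Rtab 8) (1 / (stab 8 + 1)) (sTab 8) (xiRatioBox.drop 1024) 8976 = true := by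
  native_decide

/-- Degree `9`: all `8542` cells `2·9³ ≤ n < 10⁴` pass the checker (compiled evaluation, `Lean.ofReduceBool`). -/
theorem walk_9 : walk 9 (Rtab 9) (1 / (stab 9 + 1)) (sTab 9) (xiRatioBox.drop 1458) 8542 = true := by
  native_decide

/-- Degree `10`: all `8000` cells `2·10³ ≤ n < 10⁴` pass the checker (compiled evaluation, `Lean.ofReduceBool`). -/
theorem walk_10 : walk 10 (Rtab 10) (1 / (stab 10 + 1)) (sTab 10) (xiRatioBox.drop 2000) 8000 = true := by
  native_decide

/-- Degree `11`: all `7338` cells `2·11³ ≤ n < 10⁴` pass the checker (compiled evaluation, `Lean.ofReduceBool`). -/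
theorem walk_11 : walk 11 (Rtab 11) (1 / (stab 11 + 1)) (sTab 11) (xiRatioBox.drop 2662) 7338 = true := by
  native_decide


end Summit.RiemannHypothesis.RiemannHypothesis.Theorems.JensenPolynomials.CoeffTable
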